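import Summits.BirchSwinnertonDyer.BirchSwinnertonDyer.Theorems.GenusKolyvaginAtTwoPowDvdShaCardAtTwoRTDoubleKill
import Summits.BirchSwinnertonDyer.BirchSwinnertonDyer.Theorems.GenusKolyvaginAtTwoPowDvdShaCardAtTwoRTAuxiliaryClassDeepAllPlaces
import HarnessLib

/-!
# Route `GenusKolyvaginAtTwo`, crux L_T `PowDvdShaCardAtTwoRT` (stmt-BirchSwinnertonDyer-23242), LINE 18 stub L, bottom rung:
# THE `X = 2Z` RECIPROCITY STEP IN TREE CURRENCY — the sum over the own primes and `ℓ′` vanishes, so the `ℓ′`-term must vanish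

LEAD seat `bsd-line-gk2-p1` g16 (cell `bsd-f1-sign2`), `--supports 23242 --as helper`.  THEOREMS ONLY; no `sorry`; standard axioms.
BSD is NOT proved by any of this; neither is the crux nor stub L.

WHY (memo `Cruxes/PowDvdShaCardAtTwoRT/Lines/plus-descent-lead-g16.md` §2, §9).  The engine pairs `X = 2•Z` (`Z = desc c₂(nℓ′) ∈ H¹(ℚ, A)`,
`A = E^ε[4]`) with the auxiliary `y`, both Kummer off `T′ = (own primes of n) ∪ {ℓ′}` (for `X` at the genus places this is the doubling
`2R_p ⊆ K_p`, gk2-p2 `…RTRelaxedDoubling`).  Poitou–Tate reciprocity for the Kummer structure (X11b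
`sum_invWeilPairing_localization_eq_zero_of_mem_kummerOutside`) says the local terms on `T′` sum to zero.  This file is that step with
the three kinds of own places DISPLAYED: at the FREE places `s` the class `X` vanishes (Q2 order form + imprimitivity of `(n/ℓ)ℓ′`); at the DEEP
own places `t` both `Z` and `y` lie in `L_u ⊔ H¹[2]` with `L_u` isotropic (gk2-p3's I7 / values-in-line; the doubling kills the term:
`…RTDoubleKill`); hence **the `ℓ′`-term `inv_{ℓ′}(X ∪ y)` VANISHES** — which contradicts its non-vanishing (Q2 + full-order pair Čebotarev
p693079 + local duality), closing the induction on the number of non-deep primes.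
WHAT (namespace `…Theorems.GenusExact.RelaxedCount`): `invWeilPairing_eq_zero_of_bottomRung` (displayed family `inv` with
`SumLocalTermEqZero`), `invWeilPairing_eq_zero_of_bottomRung_canonical` (THE canonical family, unconditional reciprocity),
`false_of_bottomRung` (the contradiction form).  Closes nothing.  BSD is NOT proved by any of this.

References: [McCallumLMS1991] §5 proof of Prop. 5.2, (7)–(13); [MilneADT2006] Ch. I Thm. 4.10; [Kolyvagin1991MathAnn] (2.1).
-/

set_option autoImplicit false
-- the Theorems namespace of this sub repeats the summit name by design (D-0017 nested layout)
set_option linter.dupNamespace false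

noncomputable section

open scoped Classical

open CategoryTheory Field NumberField IsDedekindDomain Function
open Literature.NumberTheory.EllipticCurves
open Literature.NumberTheory.GaloisRepresentations
open Literature.NumberTheory.GaloisCohomology
open Summit.BirchSwinnertonDyer.Rank1Residual.X11b.KummerPT
open Summit.BirchSwinnertonDyer.Rank1Residual.X11b.FiniteDuality
open Summit.BirchSwinnertonDyer.Rank1Residual.X11b.Relaxation
open Summit.BirchSwinnertonDyer.Rank1Residual.X11b.LocBridge Summit.BirchSwinnertonDyer.Rank1Residual.X11b.Levels
open Summit.BirchSwinnertonDyer.Rank1Residual.X11b.AcSelmer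
open scoped ContRepresentation

namespace Summit.BirchSwinnertonDyer.BirchSwinnertonDyer.Theorems.GenusExact.RelaxedCount

variable {K : Type} [Field K] [NumberField K] (W : WeierstrassCurve K) [W.IsElliptic]
variable (n : ℕ) [NeZero n]
variable (e : W.geomTorsion n → W.geomTorsion n → AlgebraicClosure K)
  (hμ : ∀ S T, e S T ^ n = 1)
  (hadd₁ : ∀ S₁ S₂ T, e (S₁ + S₂) T = e S₁ T * e S₂ T)
  (hadd₂ : ∀ S T₁ T₂, e S (T₁ + T₂) = e S T₁ * e S T₂)
  (hgal : ∀ (σ : absoluteGaloisGroup K) (S T : W.geomTorsion n), σ • e S T = e (σ • S) (σ • T))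
  (halt : ∀ T, e T T = 1)

include halt in
/-- **The `X = 2Z` reciprocity step.**  `inv` a family of local invariant maps with `SumLocalTermEqZero`; `T′` a finite set of places split as
«free» `s`, «deep own» `t` and one more place `l′` (`T′ = s ∪ t ∪ {l′}`, pairwise apart); `Z, y ∈ H¹(K, E[n])` with `X := 2•Z` and `y` Kummer
off `T′`; at `u ∈ s`: `loc_u X = 0`; at `u ∈ t`: `loc_u Z, loc_u y ∈ L_u ⊔ H¹(K_u,E[n])[2]` for some ISOTROPIC `L_u`.  Then the `l′`-term vanishes:
**`inv_{l′}(loc X ∪ₑ loc y) = 0`**. [cite: McCallumLMS1991, §5 proof of Prop. 5.2] [cite: MilneADT2006, Ch. I, Thm. 4.10] -/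
theorem invWeilPairing_eq_zero_of_bottomRung {inv : LocalInvariants K n} (hsum : inv.SumLocalTermEqZero)
    (s t : Finset (Place K)) (l' : Place K) (hl's : l' ∉ s) (hl't : l' ∉ t) (hst : Disjoint s t)
    {Z y : galoisCohomology (W.torsionGaloisModule (n : ℤ)) 1}
    (hX : (2 : ℕ) • Z ∈ kummerOutside W n (insert l' (s ∪ t))) (hy : y ∈ kummerOutside W n (insert l' (s ∪ t)))
    (hXs : ∀ u ∈ s, galoisCohomology.localization (W.torsionGaloisModule (n : ℤ)) u 1 ((2 : ℕ) • Z) = 0)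
    (hL : ∀ u ∈ t, ∃ L : AddSubgroup (galoisCohomology ((W.torsionGaloisModule (n : ℤ)).toLocal u) 1),
      (∀ a ∈ L, ∀ a' ∈ L, invWeilPairing W n e hμ hadd₁ hadd₂ hgal inv u a a' = 0) ∧
      galoisCohomology.localization (W.torsionGaloisModule (n : ℤ)) u 1 Z ∈ L ⊔ AddSubgroup.torsionBy _ 2 ∧
      galoisCohomology.localization (W.torsionGaloisModule (n : ℤ)) u 1 y ∈ L ⊔ AddSubgroup.torsionBy _ 2) :
    invWeilPairing W n e hμ hadd₁ hadd₂ hgal inv l'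
      (galoisCohomology.localization (W.torsionGaloisModule (n : ℤ)) l' 1 ((2 : ℕ) • Z))
      (galoisCohomology.localization (W.torsionGaloisModule (n : ℤ)) l' 1 y) = 0 := by
  have hrec := sum_invWeilPairing_localization_eq_zero_of_mem_kummerOutside W n e hμ hadd₁ hadd₂ hgal halt inv hsum
    (insert l' (s ∪ t)) hX hy
  have hl'st : l' ∉ s ∪ t := fun h ↦ by
    rcases Finset.mem_union.mp h with h | h
    · exact hl's h
    · exact hl't h
  rw [Finset.sum_insert hl'st, Finset.sum_union hst] at hrec
  -- the `s`-terms vanish: `loc_u X = 0`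
  have hs0 : ∑ u ∈ s, invWeilPairing W n e hμ hadd₁ hadd₂ hgal inv u
      (galoisCohomology.localization (W.torsionGaloisModule (n : ℤ)) u 1 ((2 : ℕ) • Z))
      (galoisCohomology.localization (W.torsionGaloisModule (n : ℤ)) u 1 y) = 0 :=
    Finset.sum_eq_zero fun u hu ↦ by rw [hXs u hu, map_zero, AddMonoidHom.zero_apply]
  -- the `t`-terms vanish: the doubling kills `L_u ⊔ H¹[2]`
  have ht0 : ∑ u ∈ t, invWeilPairing W n e hμ hadd₁ hadd₂ hgal inv u
      (galoisCohomology.localization (W.torsionGaloisModule (n : ℤ)) u 1 ((2 : ℕ) • Z))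
      (galoisCohomology.localization (W.torsionGaloisModule (n : ℤ)) u 1 y) = 0 :=
    Finset.sum_eq_zero fun u hu ↦ by
      obtain ⟨L, hLiso, hZL, hyL⟩ := hL u hu
      rw [map_nsmul]
      exact pairing_two_nsmul_eq_zero_of_mem_sup_torsionBy _ L hLiso hZL hyL
  rw [hs0, ht0, add_zero, add_zero] at hrec
  exact hrec

include halt in
/-- **Contradiction form** — the engine's use: if in addition the `l′`-term is NON-ZERO (Q2: `loc_{λ′} c₂(nℓ′)` has order 4 and meets
`H¹_f` trivially; `loc_{l′} y` generates `H¹_f`; local duality), the configuration is impossible — so some `(n/ℓ)ℓ′`, `ℓ ∈ s`, is primitive.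
[cite: McCallumLMS1991, §5 proof of Prop. 5.2] -/
theorem false_of_bottomRung {inv : LocalInvariants K n} (hsum : inv.SumLocalTermEqZero)
    (s t : Finset (Place K)) (l' : Place K) (hl's : l' ∉ s) (hl't : l' ∉ t) (hst : Disjoint s t)
    {Z y : galoisCohomology (W.torsionGaloisModule (n : ℤ)) 1}
    (hX : (2 : ℕ) • Z ∈ kummerOutside W n (insert l' (s ∪ t))) (hy : y ∈ kummerOutside W n (insert l' (s ∪ t)))
    (hXs : ∀ u ∈ s, galoisCohomology.localization (W.torsionGaloisModule (n : ℤ)) u 1 ((2 : ℕ) • Z) = 0)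
    (hL : ∀ u ∈ t, ∃ L : AddSubgroup (galoisCohomology ((W.torsionGaloisModule (n : ℤ)).toLocal u) 1),
      (∀ a ∈ L, ∀ a' ∈ L, invWeilPairing W n e hμ hadd₁ hadd₂ hgal inv u a a' = 0) ∧
      galoisCohomology.localization (W.torsionGaloisModule (n : ℤ)) u 1 Z ∈ L ⊔ AddSubgroup.torsionBy _ 2 ∧
      galoisCohomology.localization (W.torsionGaloisModule (n : ℤ)) u 1 y ∈ L ⊔ AddSubgroup.torsionBy _ 2)
    (hl' : invWeilPairing W n e hμ hadd₁ hadd₂ hgal inv l'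
      (galoisCohomology.localization (W.torsionGaloisModule (n : ℤ)) l' 1 ((2 : ℕ) • Z))
      (galoisCohomology.localization (W.torsionGaloisModule (n : ℤ)) l' 1 y) ≠ 0) : False :=
  hl' (invWeilPairing_eq_zero_of_bottomRung W n e hμ hadd₁ hadd₂ hgal halt hsum s t l' hl's hl't hst hX hy hXs hL)

include halt in
/-- **The reciprocity step for THE canonical Poitou–Tate family** (reciprocity `SumLocalTermEqZero` is the tree theorem
`sumLocalTermEqZero_canonical`): the `l′`-term vanishes. [cite: MilneADT2006, Ch. I, Thm. 4.10] -/
theorem invWeilPairing_eq_zero_of_bottomRung_canonical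
    (s t : Finset (Place K)) (l' : Place K) (hl's : l' ∉ s) (hl't : l' ∉ t) (hst : Disjoint s t)
    {Z y : galoisCohomology (W.torsionGaloisModule (n : ℤ)) 1}
    (hX : (2 : ℕ) • Z ∈ kummerOutside W n (insert l' (s ∪ t))) (hy : y ∈ kummerOutside W n (insert l' (s ∪ t)))
    (hXs : ∀ u ∈ s, galoisCohomology.localization (W.torsionGaloisModule (n : ℤ)) u 1 ((2 : ℕ) • Z) = 0)
    (hL : ∀ u ∈ t, ∃ L : AddSubgroup (galoisCohomology ((W.torsionGaloisModule (n : ℤ)).toLocal u) 1),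
      (∀ a ∈ L, ∀ a' ∈ L, invWeilPairing W n e hμ hadd₁ hadd₂ hgal (LocalInvariants.canonical K n) u a a' = 0) ∧
      galoisCohomology.localization (W.torsionGaloisModule (n : ℤ)) u 1 Z ∈ L ⊔ AddSubgroup.torsionBy _ 2 ∧
      galoisCohomology.localization (W.torsionGaloisModule (n : ℤ)) u 1 y ∈ L ⊔ AddSubgroup.torsionBy _ 2) :
    invWeilPairing W n e hμ hadd₁ hadd₂ hgal (LocalInvariants.canonical K n) l'
      (galoisCohomology.localization (W.torsionGaloisModule (n : ℤ)) l' 1 ((2 : ℕ) • Z))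
      (galoisCohomology.localization (W.torsionGaloisModule (n : ℤ)) l' 1 y) = 0 :=
  invWeilPairing_eq_zero_of_bottomRung W n e hμ hadd₁ hadd₂ hgal halt
    (Summit.BirchSwinnertonDyer.BirchSwinnertonDyer.Theorems.SchneiderFreeAdditiveX3.PoitouTateReduction.sumLocalTermEqZero_canonical
      (K := K) n) s t l' hl's hl't hst hX hy hXs hL

end Summit.BirchSwinnertonDyer.BirchSwinnertonDyer.Theorems.GenusExact.RelaxedCount

end
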